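import Literature.Probability.RandomPlanarGeometry.CritPercSLESwallowing
import HarnessLib

/-!
# The self-touching phase of SLE_κ, `4 < κ < 8`: reduction to two printed statements

Third layer of the decomposition of **crit-perc.S20**, self-touching phase,
`Literature.Probability.RandomPlanarGeometry.ae_isSelfTouching_sleTrace` (Rohde–Schramm, Ann. Math.
161 (2005), §1 p. 885 and Thm 6.4): for `4 < κ < 8`, almost surely the SLE_κ trace `γ` is
self-touching, `Loewner.IsSelfTouching γ := ¬ Injective γ ∧ interior (range γ) = ∅`.

The first two layers (`CritPercSLE.lean`, `CritPercSLESwallowing.lean`) reduce this statement to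
five named facts (`ae_isSelfTouching_sleTrace_of_lemmas`): non-simplicity (RS05 §1,
`ae_not_injective_sleTrace`), existence of the trace (RS05 Thm 5.1, `hasSLETrace_of_ne_eight`),
Lemma 6.5, Lemma 6.3 (`κ < 8`) and the first-hit consequence of Lemma 6.6. Here we observe that
**three of the five are not needed** for the self-touching statement itself, and prove

* `ae_isSelfTouching_sleTrace_of_lemma63`: `ae_isSelfTouching_sleTrace` follows from
  `ae_not_injective_sleTrace` (RS05 §1) and `exists_tendsto_sleDerivRatio_of_lt_eight`
  (RS05 Lemma 6.3, case `κ < 8`: `Z(z) < ∞` a.s.) **alone**.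

The point is the junk convention of the prelude: `sleTrace κ ω = Loewner.trace (√κ B(ω))` is the
generating curve when the chain is generated by a curve and the constant real curve `W₀ = 0`
otherwise (`Loewner.trace`). On a sample path whose chain is *not* generated by a curve the range of
the trace is `{0}`, which contains no point of `ℍ`; on a sample path whose chain *is* generated by
a curve, a point `z ∈ ℍ` with `Z(z) < ∞` is off the curve by the Koebe argument of RS05 (proof of
Thm 6.4, p. 908: "If `z ∈ ℍ`, then Lemma 6.3 and (6.2) show a.s. `z ∉ γ[0,∞)`"), proved in the
tree as `notMem_range_sleTrace_of_tendsto_sleDerivRatio`. Either way a fixed `z ∈ ℍ` is a.s. not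
on the trace (`ae_notMem_range_sleTrace_of_lemma63`, for all `0 < κ < 8`), so a.s. no rational
point of `ℍ` is, and the range — a subset of the closed half-plane — has empty interior
(`ae_interior_range_sleTrace_eq_empty_of_lemma63`). Neither the existence of the trace (Thm 5.1)
nor the swallowing statements (Lemma 6.5, Lemma 6.6, used in RS05 for `z ∈ ⋃ₜ Kₜ` and for real
`z`) enter.

What a full discharge of `ae_isSelfTouching_sleTrace` still needs after this file: the two facts
`ae_not_injective_sleTrace` (a.s. double points for `κ ∈ (4, 8)`: conformal Markov property of the
hull process, swallowing of small real points on both sides of the driving point, boundary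
behaviour of `gₛ⁻¹` at the tip — none in the tree) and `exists_tendsto_sleDerivRatio_of_lt_eight`
(Itô calculus for the flow `zₜ = gₜ(z) - Wₜ`; the tree has Itô's formula
`Literature.Analysis.FunctionSpaces.ito_formula_itoProcess_ae_holds` and the deterministic identity
(6.3), `Loewner.im_mul_norm_deriv_map_div_im_eq_exp`).

## Mathlib

We USE `MeasureTheory.ae_all_iff` (countably many null events), `exists_rat_btwn`,
`Metric.mem_nhds_iff`, `Complex.norm_le_abs_re_add_abs_im`. Mathlib has no Loewner chains / SLE.

## References

* S. Rohde, O. Schramm, *Basic properties of SLE*, Ann. of Math. 161 (2005) 883–924: §1 (p. 885: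
  "For `κ ∈ (4, 8)` the path `γ` is not a simple path and for every `z ∈ closure ℍ` a.s.
  `z ∉ γ[0, ∞)`"), Lemma 6.3 and eq. (6.2) (p. 903), Thm 6.4 and its proof (pp. 906, 908).
-/

noncomputable section

open Set Filter MeasureTheory Complex
open _root_.Topology
open UpperHalfPlane (upperHalfPlaneSet)
open scoped NNReal

namespace Literature.Probability.RandomPlanarGeometry

variable {κ : ℝ≥0}

/-- On a sample path whose chain is **not** generated by a curve, the SLE trace is the junk
constant curve `W₀ = 0`, so its range is `{0}`. [folklore] -/
theorem range_sleTrace_of_not_exists (ω : ℝ≥0 → ℝ)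
    (h : ¬ ∃ γ, Loewner.IsGeneratedByCurve (sleDriving κ ω) γ) :
    range (sleTrace κ ω) = {0} := by
  have htr : sleTrace κ ω = fun _ ↦ ((sleDriving κ ω 0 : ℝ) : ℂ) := by
    rw [sleTrace, Loewner.trace, dif_neg h]
  rw [htr, sleDriving_zero, Complex.ofReal_zero]
  exact range_const

/-- **A fixed point of `ℍ` is a.s. not on the SLE_κ trace, `0 < κ < 8`**, from Rohde–Schramm's
Lemma 6.3 (case `κ < 8`, hypothesis `h63`: a.s. the ratio `(Im z)|gₜ'(z)|/Im gₜ(z)` has a finite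
limit as `t ↑ τ(z)`) alone. On paths generated by a curve this is the Koebe argument of RS05,
proof of Thm 6.4 ("If `z ∈ ℍ`, then Lemma 6.3 and (6.2) show a.s. `z ∉ γ[0, ∞)`", p. 908;
`notMem_range_sleTrace_of_tendsto_sleDerivRatio`); on the other paths the trace is the junk
constant `0 ∉ ℍ` (`range_sleTrace_of_not_exists`). The existence of the trace (Thm 5.1) is not
used. [cite: RohdeSchramm2005, Thm 6.4 (proof, p. 908)] -/
theorem ae_notMem_range_sleTrace_of_lemma63 (h63 : exists_tendsto_sleDerivRatio_of_lt_eight)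
    (hκ0 : 0 < κ) (hκ8 : κ < 8) {z : ℂ} (hz : 0 < z.im) :
    ∀ᵐ ω ∂Process.preWienerMeasure, z ∉ range (sleTrace κ ω) := by
  filter_upwards [h63 hκ0 hκ8 z hz] with ω hω
  by_cases hg : ∃ γ, Loewner.IsGeneratedByCurve (sleDriving κ ω) γ
  · obtain ⟨Z, hZ⟩ := hω
    exact notMem_range_sleTrace_of_tendsto_sleDerivRatio (Loewner.isGeneratedByCurve_trace hg) hz hZ
  · rw [range_sleTrace_of_not_exists ω hg, mem_singleton_iff]
    intro h0
    rw [h0, Complex.zero_im] at hz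
    exact lt_irrefl _ hz

/-- A curve in the closed upper half-plane which misses every point `q₁ + i q₂` with `q₁, q₂`
rational, `q₂ > 0`, has range with empty interior: a disc `ball w r ⊆ range γ` has `Im w ≥ 0`
and contains the point `q₁ + i q₂` with `|q₁ - Re w| < r/4`, `Im w + r/4 < q₂ < Im w + r/2`.
(The topology of `ae_interior_range_sleTrace_eq_empty`, `CritPercSLE.lean`, isolated.)
[folklore] -/
theorem interior_range_eq_empty_of_forall_rat_notMem {γ : ℝ≥0 → ℂ} (him : ∀ t, 0 ≤ (γ t).im)
    (hq : ∀ q₁ q₂ : ℚ, 0 < q₂ → (⟨(q₁ : ℝ), (q₂ : ℝ)⟩ : ℂ) ∉ range γ) :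
    interior (range γ) = ∅ := by
  rw [Set.eq_empty_iff_forall_notMem]
  intro w hw
  rw [mem_interior_iff_mem_nhds, Metric.mem_nhds_iff] at hw
  obtain ⟨r, hr, hball⟩ := hw
  have hw0 : 0 ≤ w.im := by
    obtain ⟨t, ht⟩ := hball (Metric.mem_ball_self hr)
    exact ht ▸ him t
  obtain ⟨q₁, hq₁, hq₁'⟩ := exists_rat_btwn (show w.re - r / 4 < w.re + r / 4 by linarith)
  obtain ⟨q₂, hq₂, hq₂'⟩ := exists_rat_btwn (show w.im + r / 4 < w.im + r / 2 by linarith)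
  have hq₂pos : (0 : ℚ) < q₂ := by exact_mod_cast (show (0 : ℝ) < q₂ by linarith)
  refine hq q₁ q₂ hq₂pos (hball ?_)
  rw [Metric.mem_ball, dist_eq_norm]
  refine (Complex.norm_le_abs_re_add_abs_im _).trans_lt ?_
  have h₁ : |(q₁ : ℝ) - w.re| < r / 4 := abs_lt.2 ⟨by linarith, by linarith⟩
  have h₂ : |(q₂ : ℝ) - w.im| < r / 2 := abs_lt.2 ⟨by linarith, by linarith⟩
  simp only [Complex.sub_re, Complex.sub_im]
  linarith

/-- **The SLE_κ trace, `0 < κ < 8`, a.s. has range with empty interior**, from Rohde–Schramm's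
Lemma 6.3 (`κ < 8`) alone (hypothesis `h63`): almost surely none of the countably many points
`q₁ + i q₂` (`q₁, q₂ ∈ ℚ`, `q₂ > 0`) is on the trace (`ae_notMem_range_sleTrace_of_lemma63`), and
the trace lies in the closed upper half-plane for every sample path (`sleTrace_im_nonneg`).
Rohde–Schramm (2005), §1 p. 885 ("for every `z ∈ closure ℍ` a.s. `z ∉ γ[0, ∞)`"; whence
`γ[0, ∞)` has no interior). [cite: RohdeSchramm2005, §1 p. 885 and Lemma 6.3] -/
theorem ae_interior_range_sleTrace_eq_empty_of_lemma63
    (h63 : exists_tendsto_sleDerivRatio_of_lt_eight) (hκ0 : 0 < κ) (hκ8 : κ < 8) :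
    ∀ᵐ ω ∂Process.preWienerMeasure, interior (range (sleTrace κ ω)) = ∅ := by
  have hq : ∀ᵐ ω ∂Process.preWienerMeasure, ∀ p : {p : ℚ × ℚ // 0 < p.2},
      (⟨(p.1.1 : ℝ), (p.1.2 : ℝ)⟩ : ℂ) ∉ range (sleTrace κ ω) := by
    refine ae_all_iff.2 ?_
    rintro ⟨⟨q₁, q₂⟩, hq₂⟩
    have hq₂' : (0 : ℝ) < q₂ := by exact_mod_cast hq₂
    exact ae_notMem_range_sleTrace_of_lemma63 h63 hκ0 hκ8 (z := ⟨(q₁ : ℝ), (q₂ : ℝ)⟩) hq₂'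
  filter_upwards [hq] with ω hω
  exact interior_range_eq_empty_of_forall_rat_notMem (sleTrace_im_nonneg κ ω)
    fun q₁ q₂ h ↦ hω ⟨(q₁, q₂), h⟩

section CritPerc

/-- **crit-perc.S20, self-touching phase, from two printed statements**: the named fact
`ae_isSelfTouching_sleTrace` (for `4 < κ < 8` the SLE_κ trace is a.s. not injective with range of
empty interior) follows from the non-simplicity statement of Rohde–Schramm §1
(`ae_not_injective_sleTrace`, hypothesis `hA`: "For `κ ∈ (4, 8)` the path `γ` is not a simple
path", p. 885) and Lemma 6.3 for `κ < 8` (`exists_tendsto_sleDerivRatio_of_lt_eight`, hypothesis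
`h63`: `Z(z) < ∞` a.s.), through `ae_interior_range_sleTrace_eq_empty_of_lemma63`. Compared with
`ae_isSelfTouching_sleTrace_of_lemmas` (`CritPercSLESwallowing.lean`) the existence of the trace
(Thm 5.1), Lemma 6.5 and Lemma 6.6 are no longer hypotheses.
[cite: RohdeSchramm2005, §1 p. 885 and Lemma 6.3] -/
theorem ae_isSelfTouching_sleTrace_of_lemma63 (hA : ae_not_injective_sleTrace)
    (h63 : exists_tendsto_sleDerivRatio_of_lt_eight) : ae_isSelfTouching_sleTrace (κ := κ) := by
  rintro ⟨hκ, hκ'⟩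
  have hκ0 : 0 < κ := lt_trans (by norm_num) hκ
  filter_upwards [hA hκ hκ', ae_interior_range_sleTrace_eq_empty_of_lemma63 h63 hκ0 hκ']
    with ω h₁ h₂
  exact ⟨h₁, h₂⟩

end CritPerc

end Literature.Probability.RandomPlanarGeometry
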